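import Summits.BirchSwinnertonDyer.Rank1Residual.Additive.X4RankOneKimPartialShape
import Summits.BirchSwinnertonDyer.Rank1Residual.Additive.X4KimLargeImagePrimary
import Summits.BirchSwinnertonDyer.Rank1Residual.Additive.X4KimLargeImageIntegralPeriod
import HarnessLib

/-!
# The IMPLICATION LATTICE of the Kim-at-3 conjecture `Prop`s, rank `1` side: the verbatim core of
# Kim's Thm. 1.8 (6) is the top of p17's rank-one family too (team n1011, OWNERS rows T-a2 / T-a2r1 /
# T-a2r1b, lead ruling R3-21·R4-10 "§(η) implication lattice"; seat p03; sibling of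
# `X4SharpThreeKimLattice.lean`)

HONEST FRAMING (cell `b2b-bsdres`, run/shared/lean/b2b/bsd-rank1-residual/, verbatim in every
file): the goal of the cell is to DELETE the COMBINATION-SHAPED residual classes of the
Birch–Swinnerton-Dyer formula for ALL analytic-rank `≤ 1` elliptic curves over `ℚ` — "full BSD
formula for every rank `≤ 1` curve in class `C`" assembled STRICTLY from published theorems — so
that the rank-`≤ 1` remainder becomes exactly the CONSTRUCTION-SHAPED classes, which are TYPED
(missing-input `Prop`s), NOT attempted. This is not "finishing BSD". Research routes; no claim beyond
stated classes; census output = EVIDENCE / conjecture items, never a Literature fact; nothing below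
is booked; the label X4 and the marks of RESIDUAL-MAP §I N11 / O7 are UNCHANGED by this file.
NOTHING is asserted and NO new `Prop` is introduced: implications between `Prop`s already in the
tree, or from the announced [K25] record taken as an explicit hypothesis.

## What this file proves (cells/n1011/KIM-AT-3-ANATOMY.md §(η) cites these names)

* §1 `ord(δ̃) = 1` from `[0]⁺_f = 0` and `∂^{(1)}(δ̃) ≠ ∞` (the certificate-free form of p09's
  `kuriharaVanishingOrder_eq_one_of_prime_unit`: SOME cyclic prime level has a finite index).
* §2 **cc-typer-1's VERBATIM core `X4.KimShaLengthAt W p D.f` (Kim Thm. 1.8 (6), EVERY rank), granted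
  for every admissible datum under the rank-one binders, ⟹ p17's `KimRankOnePartialAt W p`** (Thm.
  1.9 (6) in analytic rank `1` with its `∂^{(∞)}` term: `length Ш[p^∞] + ∂^{(∞)} = ∂^{(1)}`): in analytic
  rank `1`, `L(E,1) = 0` kills `δ̃_1 = [0]⁺_f`, so `∂^{(0)} = ∞` and, granted `∂^{(1)} ≠ ∞`, `ord(δ̃) = 1`;
  the core at `r = 1` is then literally the partial shape. Hence the announced [K25] Thm. 1.1 own-
  currency `_OPEN` record gives `KimRankOnePartialAt` at every `p ≥ 3` MODULO the `Ω⁺_f`-integrality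
  binder (flag `Kim2025-OmegaE-integrality`, row T-R18b) — the rank-one twin of
  `kimRankZeroShaLengthAt_of_kim2025_OPEN_of_integral`; p09's `rankOne_sha_val_eq_zero_of_thm11` is its
  unit-certificate special case.
* §3 CLASS LEVEL at `3`: the seven restriction / refinement edges of p17's family that were unnamed —
  `KimThreeRankOnePartial ⟹ KimThreeRankOne ∧ KimThreeRankOneLevelTwo ∧ X4SharpThreeKimRankOnePartial`,
  `X4SharpThreeKimRankOnePartial ⟹ X4SharpThreeKimRankOne ∧ X4SharpThreeKimRankOneLevelTwo`,
  `KimThreeRankOne ⟹ X4SharpThreeKimRankOne`, `KimThreeRankOneLevelTwo ⟹ X4SharpThreeKimRankOneLevelTwo`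
  — and `KimThreeRankOnePartial` / `X4SharpThreeKimRankOnePartial` from the [K25] `_OPEN` record
  modulo integrality.

NON-EDGES recorded in §(η): no rank-`1` `∂`-exact Literature fact exists at `p ≥ 5` (cc-typer-1's
typing covers rank `0`; the tree's rank-one facts are the unit / level-two shapes), so
`KimRankOnePartialAt W p` has NO `_of_five_le` theorem today; rank-`0` and rank-`1` `Prop`s are
pairwise unrelated (disjoint binders `L(E,1) ≠ 0` / `L(E,1) = 0`), their only common ancestor being
the rank-free core `X4.KimShaLengthAt` / [K25] Thm. 1.1.

References: C.-H. Kim, Amer. J. Math. 148 (2026) = arXiv:2203.12159v4, Thm. 1.9 (1)(4)(6), §1.4.3–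
1.4.4, §1.5.1, Def. 2.13 [Kim2022StructureSelmer]; C.-H. Kim (app. R. Pollack), arXiv:2505.09121v1
(2025, PREPRINT — ANNOUNCED, flag `Kim2025-preprint`) Thm. 1.1 [Kim2025RefinedTNC]; R. Sakamoto,
JTNB 36 (2024) Thm. 1.1 [Sakamoto2024KolyvaginThree]; cell files cells/n1011/KIM-AT-3-ANATOMY.md
§(η), cells/n1011/OWNERS.md (T-a2, T-a2r1, T-a2r1b, T-a4, T-R18b).
-/

noncomputable section

open scoped Classical MatrixGroups ModularForm

open CongruenceSubgroup WeierstrassCurve Literature.NumberTheory.EllipticCurves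
  Literature.NumberTheory.EllipticCurves.ModularForms
  Literature.NumberTheory.EllipticCurves.Rank1Residual
  Literature.NumberTheory.EllipticCurves.Rank1Residual.Typed

namespace Summit.BirchSwinnertonDyer.Rank1Residual.Additive

open Summit.BirchSwinnertonDyer.Rank1Residual.X4

/-! ## §1 `ord(δ̃) = 1` without a named certificate -/

section VanishingOrder

variable (W : WeierstrassCurve ℚ) [W.IsGloballyMinimal] (p : ℕ)

/-- **`ord(δ̃) = 1` from `[0]⁺_f = 0` and `∂^{(1)}(δ̃) ≠ ∞`.** If `δ̃_1 = [0]⁺_f` vanishes (analytic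
rank `≥ 1`) the level `n = 1` has index `∞` and does not count; `∂^{(1)} ≠ ∞` means SOME cyclic
Kolyvagin prime `ℓ` has `δ̃_ℓ ≠ 0` in `ℤ_p/I_ℓ`, i.e. a finite index, so the minimum of `ν(n)` over
the non-vanishing cyclic levels is `1` (Kim §1.4.4). The certificate-free form of
`kuriharaVanishingOrder_eq_one_of_prime_unit`. [cite: Kim2022StructureSelmer, §1.4.4 and §1.5.1 (PDF p. 7), Def. 2.13 (PDF p. 14)] -/
theorem kuriharaVanishingOrder_eq_one_of_ratPlusSymbol_zero_eq_zero_of_kuriharaPartial_one_ne_top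
    {N : ℕ} {f : CuspForm (Gamma0 N) 2} (h0 : ratPlusSymbol f 0 = 0)
    (h1 : kuriharaPartial W p f 1 ≠ ⊤) : kuriharaVanishingOrder W p f = 1 := by
  -- a cyclic level with exactly one prime factor and a finite index
  have h1' := h1
  rw [kuriharaPartial_def] at h1'
  simp only [ne_eq, iInf_eq_top, not_forall] at h1'
  obtain ⟨n, hn, hcard, hlt⟩ := h1'
  refine le_antisymm ?_ ?_
  · -- `≤ 1`: the level `n`
    refine iInf_le_of_le n (iInf_le_of_le hn (iInf_le_of_le (lt_top_iff_ne_top.mpr hlt) ?_))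
    rw [hcard]
    exact le_rfl
  · -- `≥ 1`: a level with finite index is not `1` (index `⊤` there), hence has a prime factor
    refine le_iInf fun m => le_iInf fun hm => le_iInf fun hmlt => ?_
    have hm1 : m ≠ 1 := by
      rintro rfl
      rw [kuriharaDivIndex_one_eq_top_of_ratPlusSymbol_zero_eq_zero W p h0] at hmlt
      exact lt_irrefl _ hmlt
    have hm0 : m ≠ 0 := hm.1.ne_zero
    have hnonempty : m.primeFactors.Nonempty := by
      rw [Finset.nonempty_iff_ne_empty, Ne, Nat.primeFactors_eq_empty]
      omega
    exact_mod_cast Finset.card_pos.mpr hnonempty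

end VanishingOrder

/-! ## §2 Per pair, analytic rank `1`: the verbatim core ⟹ p17's `∂`-currency clause -/

section PerPairRankOne

variable (W : WeierstrassCurve ℚ) [W.IsElliptic] [W.IsGloballyMinimal] (p : ℕ) [Fact p.Prime]

/-- **The VERBATIM core `X4.KimShaLengthAt W p D.f` (every admissible datum, rank-one binders) ⟹
`KimRankOnePartialAt W p`.** Under surj(p), tower, `L(E,1) = 0`, `r_an = 1`, `Ш` finite, `D` with
`p ∤ c_D`, period transfer: `L(E,1) = 0` gives `[0]⁺_{D.f} = 0`
(`ratPlusSymbol_zero_eq_zero_of_entireLFunction_one_eq_zero`), so with `∂^{(1)} ≠ ∞` the vanishing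
order is `1` (§1) and the core at `r = 1` reads "`∂^{(∞)} = d ∈ ℕ` and `∂^{(1)} = ord_p #Ш(E/ℚ)(p) + d`"
— which is p17's conclusion `ord_p #Ш(p) + ∂^{(∞)} = ∂^{(1)}` in `ℕ∞`. So cc-typer-1's rank-free typed
core sits on TOP of the rank-one family (`KimRankOnePartialAt ⟹ KimRankOneUnitAt, KimRankOneLevelTwoAt`
are p17's `…_of_partial`). Fact-free. [cite: Kim2022StructureSelmer, Thm. 1.9 (1), (4), (6) (PDF pp. 7–8), §1.4.4 and §1.5.1 (PDF p. 7)] -/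
theorem kimRankOnePartialAt_of_forall_kimShaLengthAt
    (h : W.HasSurjectiveModNGaloisRep p → (∀ n : ℕ, W.HasSurjectiveModNGaloisRep (p ^ n : ℕ)) →
      W.entireLFunction 1 = 0 → W.analyticRank = 1 → Finite W.sha →
      ∀ {N : ℕ} [NeZero N] (D : ModularParametrizationData W N), ¬ (p : ℤ) ∣ D.maninConstant →
      (∃ u : ℚ, ‖(u : ℚ_[p])‖ = 1 ∧ W.realPeriodRat = u * plusPeriod D.f) →
      KimShaLengthAt W p D.f) :
    KimRankOnePartialAt W p := by
  intro hs ht hL hr hfin N _ D hc hper h1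
  have h0 : ratPlusSymbol D.f 0 = 0 :=
    ratPlusSymbol_zero_eq_zero_of_entireLFunction_one_eq_zero W D.isNewformOf hL
  have hord : kuriharaVanishingOrder W p D.f = 1 :=
    kuriharaVanishingOrder_eq_one_of_ratPlusSymbol_zero_eq_zero_of_kuriharaPartial_one_ne_top W p h0 h1
  obtain ⟨d, hd, h6⟩ := h hs ht hL hr hfin D hc hper 1 hord
  rw [hd, h6, Nat.cast_add]

/-- **[K25] Thm. 1.1 ("BSD") own-currency `_OPEN` record ⟹ `KimRankOnePartialAt W p` at `p ≥ 3`,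
MODULO the `Ω⁺_f`-integrality of the plus symbols of every admissible datum** (`hint`; flag
`Kim2025-OmegaE-integrality`, row T-R18b) — the rank-one twin of
`kimRankZeroShaLengthAt_of_kim2025_OPEN_of_integral`; p09's `rankOne_sha_val_eq_zero_of_thm11` is the
unit-certificate special case. NOTE (honest, unchanged from p17's docstrings): [K25]'s own rank-one
statements Thm. 1.2 (rk1+ε) / Cor. 1.10 carry `p² ∤ N` and are NOT used — only Thm. 1.1's structure
clause, whose non-vanishing premise is WITNESSED by `∂^{(1)} ≠ ∞`. CONDITIONAL on the preprint.
[claim: Kim2025RefinedTNC, status: under-review]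
[cite: Kim2025RefinedTNC, Thm. 1.1 (Str)/("BSD") (ANNOUNCED preprint — the reason, not a source of truth)]
[cite: Sakamoto2024KolyvaginThree, Thm. 1.1] [cite: Kim2022StructureSelmer, §1.4.1 (PDF p. 7)] -/
theorem kimRankOnePartialAt_of_kim2025_OPEN_of_integral
    (hK25s : Kim2025.thm11_kimShaLength_of_integralPeriod_OPEN) (hp3 : 3 ≤ p)
    (hint : ∀ {N : ℕ} [NeZero N] (D : ModularParametrizationData W N), ¬ (p : ℤ) ∣ D.maninConstant →
      ∀ r : ℚ, ratPlusSymbol D.f r ≠ 0 → 0 ≤ padicValRat p (ratPlusSymbol D.f r)) :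
    KimRankOnePartialAt W p :=
  kimRankOnePartialAt_of_forall_kimShaLengthAt W p fun _ ht _ _ hfin _ _ D hc _ =>
    kimShaLengthAt_of_kim2025_OPEN W p hK25s hp3 ht hfin D.isNewformOf (hint D hc)

end PerPairRankOne

/-! ## §3 Class level at `p = 3` (rank `1`): the missing edges of p17's family -/

section ClassLevel

/-- `KimThreeRankOnePartial ⟹ KimThreeRankOne` (every curve; per pair `kimRankOneUnitAt_of_partial`).
Bookkeeping. [cite: Kim2022StructureSelmer, Thm. 1.9 (1), (4), (6) (PDF pp. 7–8)] -/
theorem kimThreeRankOne_of_kimThreeRankOnePartial (h : KimThreeRankOnePartial) : KimThreeRankOne :=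
  fun W _ _ => kimRankOneUnitAt_of_partial W 3 (h W)

/-- `KimThreeRankOnePartial ⟹ KimThreeRankOneLevelTwo` (per pair `kimRankOneLevelTwoAt_of_partial`).
Bookkeeping. [cite: Kim2022StructureSelmer, Thm. 1.9 (6), §1.2.2 (PDF pp. 5–8)] -/
theorem kimThreeRankOneLevelTwo_of_kimThreeRankOnePartial (h : KimThreeRankOnePartial) :
    KimThreeRankOneLevelTwo :=
  fun W _ _ => kimRankOneLevelTwoAt_of_partial W 3 (h W)

/-- `X4SharpThreeKimRankOnePartial ⟹ X4SharpThreeKimRankOne` (additive rows). Bookkeeping.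
[cite: Kim2022StructureSelmer, Thm. 1.9 (1), (4), (6) (PDF pp. 7–8)] -/
theorem x4SharpThreeKimRankOne_of_x4SharpThreeKimRankOnePartial (h : X4SharpThreeKimRankOnePartial) :
    X4SharpThreeKimRankOne :=
  fun W _ _ hA => kimRankOneUnitAt_of_partial W 3 (h W hA)

/-- `X4SharpThreeKimRankOnePartial ⟹ X4SharpThreeKimRankOneLevelTwo` (additive rows). Bookkeeping.
[cite: Kim2022StructureSelmer, Thm. 1.9 (6), §1.2.2 (PDF pp. 5–8)] -/
theorem x4SharpThreeKimRankOneLevelTwo_of_x4SharpThreeKimRankOnePartial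
    (h : X4SharpThreeKimRankOnePartial) : X4SharpThreeKimRankOneLevelTwo :=
  fun W _ _ hA => kimRankOneLevelTwoAt_of_partial W 3 (h W hA)

/-- `KimThreeRankOne ⟹ X4SharpThreeKimRankOne` (restriction to the additive rows). Bookkeeping. [folklore] -/
theorem x4SharpThreeKimRankOne_of_kimThreeRankOne (h : KimThreeRankOne) : X4SharpThreeKimRankOne :=
  fun W _ _ _ => h W

/-- `KimThreeRankOneLevelTwo ⟹ X4SharpThreeKimRankOneLevelTwo` (restriction). Bookkeeping. [folklore] -/
theorem x4SharpThreeKimRankOneLevelTwo_of_kimThreeRankOneLevelTwo (h : KimThreeRankOneLevelTwo) :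
    X4SharpThreeKimRankOneLevelTwo :=
  fun W _ _ _ => h W

/-- `KimThreeRankOnePartial ⟹ X4SharpThreeKimRankOnePartial` (restriction). Bookkeeping. [folklore] -/
theorem x4SharpThreeKimRankOnePartial_of_kimThreeRankOnePartial (h : KimThreeRankOnePartial) :
    X4SharpThreeKimRankOnePartial :=
  fun W _ _ _ => h W

/-- **[K25] Thm. 1.1 own-currency `_OPEN` ⟹ `KimThreeRankOnePartial`, MODULO the `Ω⁺_f`-integrality of
every admissible datum of every curve** (`hint`; flag `Kim2025-OmegaE-integrality`, row T-R18b): the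
announced statement on top of the whole rank-`1` lattice at `3` (`⟹ KimThreeRankOne`,
`KimThreeRankOneLevelTwo`, `X4SharpThreeKimRankOne{,LevelTwo,Partial}`). CONDITIONAL on the preprint.
[claim: Kim2025RefinedTNC, status: under-review]
[cite: Kim2025RefinedTNC, Thm. 1.1 (Str)/("BSD") (ANNOUNCED preprint — the reason, not a source of truth)]
[cite: Sakamoto2024KolyvaginThree, Thm. 1.1] -/
theorem kimThreeRankOnePartial_of_kim2025_OPEN_of_integral
    (hK25s : Kim2025.thm11_kimShaLength_of_integralPeriod_OPEN)
    (hint : ∀ (W : WeierstrassCurve ℚ) [W.IsElliptic] [W.IsGloballyMinimal]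
      {N : ℕ} [NeZero N] (D : ModularParametrizationData W N), ¬ (3 : ℤ) ∣ D.maninConstant →
      ∀ r : ℚ, ratPlusSymbol D.f r ≠ 0 → 0 ≤ padicValRat 3 (ratPlusSymbol D.f r)) :
    KimThreeRankOnePartial :=
  fun W _ _ => kimRankOnePartialAt_of_kim2025_OPEN_of_integral W 3 hK25s le_rfl
    (fun D hc => hint W D hc)

/-- **[K25] Thm. 1.1 own-currency `_OPEN` ⟹ `X4SharpThreeKimRankOnePartial`** (the O7 ∩ X4@3
hypothesis in `∂`-currency), MODULO the integrality of the admissible data of the ADDITIVE rows only.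
CONDITIONAL on the preprint. [claim: Kim2025RefinedTNC, status: under-review]
[cite: Kim2025RefinedTNC, Thm. 1.1 (Str)/("BSD") (ANNOUNCED preprint — the reason, not a source of truth)]
[cite: Sakamoto2024KolyvaginThree, Thm. 1.1] -/
theorem x4SharpThreeKimRankOnePartial_of_kim2025_OPEN_of_integral
    (hK25s : Kim2025.thm11_kimShaLength_of_integralPeriod_OPEN)
    (hint : ∀ (W : WeierstrassCurve ℚ) [W.IsElliptic] [W.IsGloballyMinimal], Addv W 3 →
      ∀ {N : ℕ} [NeZero N] (D : ModularParametrizationData W N), ¬ (3 : ℤ) ∣ D.maninConstant →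
      ∀ r : ℚ, ratPlusSymbol D.f r ≠ 0 → 0 ≤ padicValRat 3 (ratPlusSymbol D.f r)) :
    X4SharpThreeKimRankOnePartial :=
  fun W _ _ hA => kimRankOnePartialAt_of_kim2025_OPEN_of_integral W 3 hK25s le_rfl
    (fun D hc => hint W hA D hc)

end ClassLevel

end Summit.BirchSwinnertonDyer.Rank1Residual.Additive

end
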